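import Mathlib
import HarnessLib
import Literature.NumberTheory.DiophantineGeometry.RothPrelim
import Literature.NumberTheory.DiophantineGeometry.RothTaylor
import Literature.NumberTheory.DiophantineGeometry.RothWronskianOne

/-!
# Roth's theorem after Schmidt (LNM 785, Ch. V) — §9: generalized Wronskians (Lemma 9A)

Source: W. M. Schmidt, *Diophantine Approximation*, LNM 785 (1980), Ch. V §9, Lemma 9A
[Schmidt1980]; proof via the Kronecker substitution as in E. Bombieri, W. Gubler, *Heights in
Diophantine Geometry* (2006), Prop. 6.3.10 [BombieriGubler2006].

**Lemma 9A** (for polynomials). If `φ₀, …, φ_{k-1} ∈ K[X₀, …, X_{n-1}]` are linearly independent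
over a field `K` of characteristic `0`, then some generalized Wronskian
`det (Δ_s φ_j)_{s,j<k}`, with `Δ_s` a differential operator of order `≤ s`, does not vanish.
Here (`Roth.exists_generalizedWronskian_ne_zero`) the operators are Schmidt's normalised ones,
`Δ_s = P ↦ P_{μ_s}` (`Roth.hasseD (μ s)`) with `|μ_s| ≤ s` — exactly the operators `Δ'_i` used in
the proof of Roth's Lemma (10.9). (Schmidt states 9A for rational functions; only the polynomial
case is used in Ch. V, and it is what Bombieri–Gubler prove.)

Proof (Bombieri–Gubler): with `d` exceeding all partial degrees, the Kronecker substitution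
`X_h ↦ t^{d^h}` (`Roth.kron`) is injective on the span of the `φ_j`
(`Roth.eq_zero_of_aeval_kron_eq_zero`), so the `Φ_j(t) = φ_j(t, t^d, …)` are linearly independent
and their Hasse–Wronskian is non-zero (`Roth.hwronskian_ne_zero`, `RothWronskianOne.lean`);
comparing the Taylor expansions of `Φ_j(t + u)` in `u` (one variable, Mathlib's `Polynomial.taylor`)
and of `φ_j` at `(t, t^d, …)` (several variables, `Roth.taylor_formula_of_subset`) gives
`(1/s!) Φ_j^{(s)} = Σ_{|μ| ≤ s} a_{μ,s}(t) (φ_j)_μ(t, t^d, …)` with universal `a_{μ,s}`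
(`Roth.hasseDeriv_aeval_kron`), and multilinearity of the determinant finishes.

## References

* [Schmidt1980] W. M. Schmidt, *Diophantine Approximation*, LNM 785, Springer 1980, Ch. V
  Lemma 9A, pp. 127–129.
* [BombieriGubler2006] E. Bombieri, W. Gubler, *Heights in Diophantine Geometry*, CUP 2006,
  Proposition 6.3.10.
-/

noncomputable section

open MvPolynomial Finset

namespace Literature.NumberTheory.DiophantineGeometry

namespace Roth

variable {K : Type*} [Field K]

/-! ### The Kronecker substitution -/

/-- The Kronecker substitution `X_h ↦ t^{d^h}`. [cite: BombieriGubler2006, Prop. 6.3.10 (proof)] -/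
def kron {n : ℕ} (d : ℕ) : Fin n → Polynomial K := fun h => Polynomial.X ^ (d ^ (h : ℕ))

/-- The exponent `Σ_h e_h d^h` of the image of the monomial `X^e`. [folklore] -/
def kronIndex {n : ℕ} (d : ℕ) (e : Fin n → ℕ) : ℕ := ∑ h, e h * d ^ (h : ℕ)

/-- `MvPolynomial.aeval kron (c X^e) = c t^{Σ e_h d^h}`. [folklore] -/
theorem aeval_kron_monomial {n : ℕ} (d : ℕ) (e : Fin n →₀ ℕ) (c : K) :
    MvPolynomial.aeval (kron d) (monomial e c) = Polynomial.C c * Polynomial.X ^ (kronIndex d e) := by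
  rw [MvPolynomial.aeval_monomial, Finsupp.prod_fintype _ _ (fun h => pow_zero _), kronIndex,
    ← prod_pow_eq_pow_sum]
  congr 1
  exact prod_congr rfl fun h _ => by rw [kron, ← pow_mul, mul_comm]

/-- Base-`d` digits: `e ↦ Σ_h e_h d^h` is injective on tuples with entries `< d`. [folklore] -/
theorem kronIndex_injective {n : ℕ} (d : ℕ) {e e' : Fin n → ℕ} (he : ∀ h, e h < d)
    (he' : ∀ h, e' h < d) (heq : kronIndex d e = kronIndex d e') : e = e' := by
  induction n with
  | zero => exact funext fun h => h.elim0
  | succ n ih =>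
    have hd : 0 < d := lt_of_le_of_lt (Nat.zero_le _) (he 0)
    have hsplit : ∀ f : Fin (n + 1) → ℕ,
        kronIndex d f = f 0 + d * kronIndex d (fun h : Fin n => f h.succ) := by
      intro f
      rw [kronIndex, kronIndex, Fin.sum_univ_succ, mul_sum]
      simp only [Fin.val_zero, pow_zero, mul_one, Fin.val_succ, pow_succ]
      congr 1
      exact sum_congr rfl fun h _ => by ring
    rw [hsplit e, hsplit e'] at heq
    have h0 : e 0 = e' 0 := by
      have := congrArg (· % d) heq
      simpa [Nat.add_mul_mod_self_left, Nat.mod_eq_of_lt (he 0), Nat.mod_eq_of_lt (he' 0)] using this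
    have htail : kronIndex d (fun h : Fin n => e h.succ) = kronIndex d (fun h : Fin n => e' h.succ) := by
      rw [h0] at heq
      have := Nat.add_left_cancel heq
      exact Nat.eq_of_mul_eq_mul_left hd this
    have ih' := ih (fun h => he h.succ) (fun h => he' h.succ) htail
    funext h
    refine Fin.cases h0 (fun h => ?_) h
    exact congrFun ih' h

/-- **Injectivity of the Kronecker substitution** on polynomials with all partial degrees `< d`.
[cite: BombieriGubler2006, Prop. 6.3.10 (proof)] -/
theorem eq_zero_of_aeval_kron_eq_zero {n : ℕ} {d : ℕ} (Q : MvPolynomial (Fin n) K)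
    (hdeg : ∀ h, degreeOf h Q < d) (h0 : MvPolynomial.aeval (kron (K := K) d) Q = 0) : Q = 0 := by
  classical
  by_contra hQ
  obtain ⟨e, he⟩ := MvPolynomial.ne_zero_iff.mp hQ
  have hsupp : ∀ e' ∈ Q.support, ∀ h, e' h < d := fun e' he' h =>
    lt_of_le_of_lt (monomial_le_degreeOf h he') (hdeg h)
  have hes : e ∈ Q.support := mem_support_iff.mpr he
  have hexp : MvPolynomial.aeval (kron d) Q =
      ∑ e' ∈ Q.support, Polynomial.C (coeff e' Q) * Polynomial.X ^ (kronIndex d e') := by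
    conv_lhs => rw [Q.as_sum, map_sum]
    exact sum_congr rfl fun e' _ => aeval_kron_monomial d e' _
  have hcoeff : (MvPolynomial.aeval (kron d) Q).coeff (kronIndex d e) = coeff e Q := by
    rw [hexp, Polynomial.finsetSum_coeff, sum_eq_single e]
    · simp
    · intro e' he' hne
      rw [Polynomial.coeff_C_mul, Polynomial.coeff_X_pow, if_neg, mul_zero]
      intro hidx
      exact hne (DFunLike.coe_injective
        (kronIndex_injective d (hsupp e' he') (hsupp e hes) hidx.symm))
    · intro h; exact absurd hes h
  rw [h0, Polynomial.coeff_zero] at hcoeff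
  exact he hcoeff.symm

/-! ### Hasse derivatives of a Kronecker substitution -/

/-- `hasseDeriv` commutes with a change of coefficients. [folklore] -/
theorem hasseDeriv_map {R S : Type*} [CommSemiring R] [CommSemiring S] (f : R →+* S) (s : ℕ)
    (p : Polynomial R) :
    Polynomial.hasseDeriv s (p.map f) = (Polynomial.hasseDeriv s p).map f := by
  ext m
  simp [Polynomial.hasseDeriv_coeff, Polynomial.coeff_map]

/-- `Φ(u + t)` for `Φ = φ(t, t^d, …)`: the Taylor shift of a Kronecker substitution is the
substitution `X_h ↦ (u + t)^{d^h}` (in `K[t][u]`). [cite: BombieriGubler2006, Prop. 6.3.10 (proof)] -/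
theorem taylor_map_aeval_kron {n : ℕ} (d : ℕ) (Q : MvPolynomial (Fin n) K) :
    Polynomial.taylor (Polynomial.X : Polynomial K)
        ((MvPolynomial.aeval (kron (K := K) d) Q).map (Polynomial.C : K →+* Polynomial K)) =
      MvPolynomial.aeval (fun h : Fin n =>
        ((Polynomial.X + Polynomial.C Polynomial.X : Polynomial (Polynomial K)) ^ (d ^ (h : ℕ)))) Q := by
  induction Q using MvPolynomial.induction_on with
  | C c =>
    rw [MvPolynomial.aeval_C, MvPolynomial.aeval_C, ← Polynomial.C_eq_algebraMap, Polynomial.map_C,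
      Polynomial.taylor_C]
    rfl
  | add p q hp hq => rw [map_add, Polynomial.map_add, map_add, hp, hq, map_add]
  | mul_X p h hp =>
    rw [map_mul, Polynomial.map_mul, Polynomial.taylor_mul, hp, map_mul, MvPolynomial.aeval_X,
      MvPolynomial.aeval_X, kron, Polynomial.map_pow, Polynomial.map_X, Polynomial.taylor_X_pow]

/-- Constants come out of a substitution of constants. [folklore] -/
theorem aeval_C_comp {n : ℕ} (g : Fin n → Polynomial K) (Q : MvPolynomial (Fin n) K) :
    MvPolynomial.aeval (fun h => (Polynomial.C (g h) : Polynomial (Polynomial K))) Q =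
      Polynomial.C (MvPolynomial.aeval g Q) := by
  induction Q using MvPolynomial.induction_on with
  | C c => simp
  | add p p' hp hp' => rw [map_add, map_add, hp, hp', Polynomial.C_add]
  | mul_X p h hp => rw [map_mul, map_mul, hp, MvPolynomial.aeval_X, MvPolynomial.aeval_X, Polynomial.C_mul]

section Formula

variable {n : ℕ}

/-- The universal coefficients `a_{μ,s}(t)` of Bombieri–Gubler: the coefficient of `u^s` in
`Π_h ((u + t)^{d^h} - t^{d^h})^{μ_h} ∈ K[t][u]`. [cite: BombieriGubler2006, Prop. 6.3.10 (proof)] -/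
def kronCoeff (d : ℕ) (μ : Fin n →₀ ℕ) (s : ℕ) : Polynomial K :=
  (∏ h : Fin n, ((Polynomial.X + Polynomial.C Polynomial.X) ^ (d ^ (h : ℕ)) -
    Polynomial.C (Polynomial.X ^ (d ^ (h : ℕ))) : Polynomial (Polynomial K)) ^ (μ h)).coeff s

/-- `a_{μ,s} = 0` unless `|μ| ≤ s` (each factor is divisible by `u`).
[cite: BombieriGubler2006, Prop. 6.3.10 (proof)] -/
theorem kronCoeff_eq_zero_of_lt (d : ℕ) (μ : Fin n →₀ ℕ) (s : ℕ) (hs : s < ∑ h, μ h) :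
    kronCoeff (K := K) d μ s = 0 := by
  unfold kronCoeff
  set E : Fin n → Polynomial (Polynomial K) := fun h =>
    ((Polynomial.X + Polynomial.C Polynomial.X) ^ (d ^ (h : ℕ)) -
      Polynomial.C (Polynomial.X ^ (d ^ (h : ℕ)))) with hE
  have hdvd : ∀ h, (Polynomial.X : Polynomial (Polynomial K)) ∣ E h := by
    intro h
    rw [Polynomial.X_dvd_iff, hE]
    simp [Polynomial.coeff_zero_eq_eval_zero]
  have hdvd' : (Polynomial.X : Polynomial (Polynomial K)) ^ (∑ h, μ h) ∣ ∏ h, E h ^ (μ h) := by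
    rw [← prod_pow_eq_pow_sum]
    exact Finset.prod_dvd_prod_of_dvd _ _ fun h _ => pow_dvd_pow_of_dvd (hdvd h) _
  obtain ⟨G, hG⟩ := hdvd'
  change (∏ h, E h ^ (μ h)).coeff s = 0
  rw [hG, Polynomial.coeff_X_pow_mul', if_neg (not_le.mpr hs)]

/-- **Hasse derivatives of a Kronecker substitution** (Bombieri–Gubler): for `φ` of partial
degrees `≤ D` in every variable,
`(1/s!) (d/dt)^s φ(t, t^d, …) = Σ_{μ ≤ (D,…,D)} a_{μ,s}(t) · φ_μ(t, t^d, …)`, with the universal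
polynomials `a_{μ,s} = kronCoeff d μ s`. [cite: BombieriGubler2006, Prop. 6.3.10 (proof)] -/
theorem hasseDeriv_aeval_kron (d : ℕ) (φ : MvPolynomial (Fin n) K) (D : Fin n → ℕ)
    (hD : ∀ h, degreeOf h φ ≤ D h) (s : ℕ) :
    Polynomial.hasseDeriv s (MvPolynomial.aeval (kron (K := K) d) φ) =
      ∑ μ ∈ Finset.Iic (Finsupp.equivFunOnFinite.symm D),
        kronCoeff d μ s * MvPolynomial.aeval (kron d) (hasseD μ φ) := by
  classical
  set A := Polynomial K
  set F : A := MvPolynomial.aeval (kron d) φ with hF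
  -- Taylor in one variable: `F(u + t)` and its coefficients
  have h1 : ∀ s, (Polynomial.taylor (Polynomial.X : A) (F.map Polynomial.C)).coeff s =
      Polynomial.hasseDeriv s F := by
    intro s
    rw [Polynomial.taylor_coeff, hasseDeriv_map, Polynomial.eval_map, Polynomial.eval₂_C_X]
  -- `F(u + t)` as a substitution
  set xB : Fin n → Polynomial A := fun h =>
    (Polynomial.X + Polynomial.C Polynomial.X) ^ (d ^ (h : ℕ)) with hxB
  set aB : Fin n → Polynomial A := fun h => Polynomial.C (Polynomial.X ^ (d ^ (h : ℕ))) with haB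
  have h2 : Polynomial.taylor (Polynomial.X : A) (F.map Polynomial.C) = MvPolynomial.aeval xB φ :=
    taylor_map_aeval_kron d φ
  -- Taylor in several variables at the point `(t, t^d, …)`
  have h3 : MvPolynomial.aeval xB φ = ∑ μ ∈ Finset.Iic (Finsupp.equivFunOnFinite.symm D),
      MvPolynomial.aeval aB (hasseD μ φ) * ∏ h, (xB h - aB h) ^ (μ h) :=
    taylor_formula_of_subset aB xB φ fun μ hμ => mem_Iic_of_hasseD_ne_zero D hD hμ
  have h4 : ∀ μ, MvPolynomial.aeval aB (hasseD μ φ) = Polynomial.C (MvPolynomial.aeval (kron d) (hasseD μ φ)) := by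
    intro μ
    rw [haB]
    exact aeval_C_comp (kron d) (hasseD μ φ)
  rw [← h1 s, h2, h3, Polynomial.finsetSum_coeff]
  refine sum_congr rfl fun μ _ => ?_
  rw [h4, Polynomial.coeff_C_mul, mul_comm]
  rfl

end Formula

/-! ### Lemma 9A -/

/-- **Lemma 9A** (Schmidt, Ch. V; Bombieri–Gubler Prop. 6.3.10), polynomial case: if
`φ₀, …, φ_{k-1} ∈ K[X₀, …, X_{n-1}]` are linearly independent over a field `K` of
characteristic `0`, then there are multi-indices `μ₀, …, μ_{k-1}` with `|μ_s| ≤ s` such that the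
generalized Wronskian `det ((φ_j)_{μ_s})_{s,j<k}` is non-zero. [cite: Schmidt1980, Ch. V Lemma 9A] -/
theorem exists_generalizedWronskian_ne_zero [CharZero K] {k n : ℕ}
    (φ : Fin k → MvPolynomial (Fin n) K) (hφ : LinearIndependent K φ) :
    ∃ μ : Fin k → (Fin n →₀ ℕ), (∀ s, ∑ h, μ s h ≤ (s : ℕ)) ∧
      Matrix.det (Matrix.of fun s j : Fin k => hasseD (μ s) (φ j)) ≠ 0 := by
  classical
  -- a bound for all partial degrees
  set D : ℕ := univ.sup fun j : Fin k => univ.sup fun h : Fin n => degreeOf h (φ j) with hDdef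
  have hD : ∀ j h, degreeOf h (φ j) ≤ D := fun j h =>
    (Finset.le_sup (f := fun h : Fin n => degreeOf h (φ j)) (mem_univ h)).trans
      (Finset.le_sup (f := fun j : Fin k => univ.sup fun h : Fin n => degreeOf h (φ j)) (mem_univ j))
  set d : ℕ := D + 1 with hd
  -- the substituted polynomials are linearly independent
  set Φ : Fin k → Polynomial K := fun j => MvPolynomial.aeval (kron d) (φ j) with hΦ
  have hΦli : LinearIndependent K Φ := by
    rw [Fintype.linearIndependent_iff]
    intro c hc
    have h0 : MvPolynomial.aeval (kron (K := K) d) (∑ j, c j • φ j) = 0 := by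
      rw [map_sum]; simpa [hΦ] using hc
    have hdeg : ∀ h, degreeOf h (∑ j, c j • φ j) < d := by
      intro h
      refine lt_of_le_of_lt (degreeOf_sum_le _ _ _) ?_
      rw [hd, Nat.lt_succ_iff, Finset.sup_le_iff]
      intro j _
      rw [MvPolynomial.smul_eq_C_mul]
      exact (degreeOf_C_mul_le _ _ _).trans (hD j h)
    have := eq_zero_of_aeval_kron_eq_zero _ hdeg h0
    exact Fintype.linearIndependent_iff.mp hφ c this
  have hW : hwronskian Φ ≠ 0 := hwronskian_ne_zero Φ hΦli
  -- expand the Wronskian by multilinearity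
  set T : Finset (Fin n →₀ ℕ) := Finset.Iic (Finsupp.equivFunOnFinite.symm fun _ : Fin n => D)
    with hT
  set G : (Fin n →₀ ℕ) → Fin k → Polynomial K := fun μ j => MvPolynomial.aeval (kron d) (hasseD μ (φ j))
    with hG
  have hrow : ∀ s : Fin k, (fun j => Polynomial.hasseDeriv (s : ℕ) (Φ j)) =
      ∑ μ ∈ T, kronCoeff (K := K) d μ s • G μ := by
    intro s
    funext j
    rw [Finset.sum_apply]
    simp only [Pi.smul_apply, smul_eq_mul]
    exact hasseDeriv_aeval_kron d (φ j) (fun _ => D) (fun h => hD j h) s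
  have hdet : hwronskian Φ = ∑ τ ∈ Fintype.piFinset (fun _ : Fin k => T),
      (∏ s, kronCoeff (K := K) d (τ s) s) * Matrix.det (Matrix.of fun s j => G (τ s) j) := by
    unfold hwronskian
    have hM : (Matrix.of fun s j : Fin k => Polynomial.hasseDeriv (s : ℕ) (Φ j)) =
        fun s : Fin k => ∑ μ ∈ T, kronCoeff (K := K) d μ (s : ℕ) • G μ := by
      funext s; exact hrow s
    rw [hM]
    change Matrix.detRowAlternating _ = _
    rw [← AlternatingMap.coe_multilinearMap, MultilinearMap.map_sum_finset]
    refine sum_congr rfl fun τ _ => ?_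
    rw [MultilinearMap.map_smul_univ, smul_eq_mul]
    rfl
  rw [hdet] at hW
  obtain ⟨τ, hτ, hne⟩ := Finset.exists_ne_zero_of_sum_ne_zero hW
  refine ⟨τ, fun s => ?_, ?_⟩
  · by_contra hlt
    apply hne
    rw [prod_eq_zero (mem_univ s) (kronCoeff_eq_zero_of_lt d (τ s) s (not_le.mp hlt)), zero_mul]
  · intro h0
    apply hne
    have : Matrix.det (Matrix.of fun s j => G (τ s) j) =
        MvPolynomial.aeval (kron d) (Matrix.det (Matrix.of fun s j : Fin k => hasseD (τ s) (φ j))) := by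
      rw [AlgHom.map_det]
      rfl
    rw [this, h0, map_zero, mul_zero]

end Roth

end Literature.NumberTheory.DiophantineGeometry
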